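import Mathlib

/-!
# Route BarrierLever — item `PartitionMinorsHitByVP` (stmt-ValiantsHypothesis-19717), line `hidden-states`:
# THE SPLIT LEMMA — goodness along one coordinate from goodness of the deletion and of the link (generic peeling)

Helper file (`--supports stmt-ValiantsHypothesis-19717`; cell valiant-natproofs, rung V4, 𝒟-side door (c), registered line
`Cruxes/PartitionMinorsHitByVP/Lines/hidden_states.lean` v2, lane `stub_universalJoinWide`; prover seat val-np-p3 gen 10).
Bookkeeping `def`s only (`splitMat`, `revMat`). Mathlib-only. Closes NO item: it is the ENGINE of the recursive fitting criterion
(memo val-np-p3 g10 §10), the coordinate-by-coordinate degeneration that certifies GOOD for hidden-state join designs.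

THE POINT. Fix a coordinate `x`. Rows `u i` either avoid `x` (the DELETION rows) or contain it (the LINK rows, `W ∪ {x}`); columns
`k` are points whose coordinates `a ≠ x` are arbitrary numbers `z' k a` and whose `x`-coordinate is `η k + t·ξ k` for a scale `t`;
call a column UNSCALED if `ξ k = 0` and SCALED otherwise. The `(i,k)` entry `∏_{a ∈ u i} z_k(a)` is, for a link row, `(η k + t ξ k)·∏_{a∈W} z' k a`.
If #scaled columns = #link rows, then as `t → ∞` the determinant is `t^{#link} · (det A · det D₁) + lower order`, where
`A = [∏_{a∈U} z' k a]` (deletion rows × unscaled columns) and `D₁ = [ξ k ∏_{a∈W} z' k a]` (link rows × scaled columns).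
Hence (`det_ne_zero_of_split`): `det A ≠ 0 ∧ det D₁ ≠ 0 ⇒ ∃ t, det ≠ 0`. We prove it with the reversed scale `Y = 1/t`:
`N(Y) = diag(Y^{[x ∈ u i]}) · M(1/Y)` is a polynomial matrix with `N(0) = [[A, B], [0, D₁]]` block-triangular
(`Matrix.det_fromBlocks_zero₂₁`), so `det N` is a nonzero polynomial in `Y`, nonzero at some `Y₀ ≠ 0`, and `t = 1/Y₀` works.

USE (memo §10, criterion F⁺). For a join piece with frame `(c, s)` put `c_x = c̃_x + t β`, `s_{q,x} = s̃_{q,x} ± t` for `q ∈ Q^±`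
(else `s̃`): the hidden point of member `J` has `x`-coordinate `η_J + t ξ_J` with `ξ_J = β + |J ∩ Q⁺| − |J ∩ Q⁻|`, so the piece SPLITS
into `{ξ_J = 0}` (unscaled) and `{ξ_J ≠ 0}` (scaled); `A` is the block-additive matrix of the deletion `𝒰₀` against the unscaled
sub-families and `D₁` that of the link `𝒰₁` against the scaled ones (times the nonzero constants `ξ`), both in dimension `h − 1` and with
the same (generic) frames. Iterating over the coordinates gives the recursive FITTING criterion, which certifies every tested design/family
pair at h ≤ 5 (lab/fitting2.py) and is the proposed route to a proof of the conjecture node for greedy-ball designs.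

WHAT THIS IS NOT: a sufficient condition only; no family is certified here; item 19717 OPEN; nothing on crux 14610 or VP ≠ VNP.
-/

set_option linter.dupNamespace false

namespace Summit.ValiantsHypothesis.ValiantsHypothesis.Theorems.BarrierLever.HiddenStates

open Finset Matrix Polynomial

noncomputable section

namespace Split

variable {h r₀ r₁ : ℕ}

/-- Row/column index type of a split problem: `r₀` deletion rows / unscaled columns, `r₁` link rows / scaled columns. -/
abbrev Idx (r₀ r₁ : ℕ) := Fin r₀ ⊕ Fin r₁

/-- The matrix at scale `t`: entry `∏_{a ∈ u i} z_k(a)` with `z_k(x) = η k + t ξ k` and `z_k(a) = z' k a` for `a ≠ x`. -/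
def splitMat (x : Fin h) (u : Idx r₀ r₁ → Finset (Fin h)) (z' : Idx r₀ r₁ → Fin h → ℂ) (ξ η : Idx r₀ r₁ → ℂ) (t : ℂ) :
    Matrix (Idx r₀ r₁) (Idx r₀ r₁) ℂ :=
  Matrix.of fun i k => ∏ a ∈ u i, (if a = x then η k + t * ξ k else z' k a)

/-- The reversed-scale polynomial matrix `N(Y)`: entry `(ξ k + Y η k)^{[x ∈ u i]} · ∏_{a ∈ u i, a ≠ x} z' k a`. -/
def revMat (x : Fin h) (u : Idx r₀ r₁ → Finset (Fin h)) (z' : Idx r₀ r₁ → Fin h → ℂ) (ξ η : Idx r₀ r₁ → ℂ) :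
    Matrix (Idx r₀ r₁) (Idx r₀ r₁) ℂ[X] :=
  Matrix.of fun i k => (if x ∈ u i then C (ξ k) + X * C (η k) else 1) * C (∏ a ∈ (u i).erase x, z' k a)

/-- The product over `u i` splits off the `x`-factor. -/
theorem prod_split (x : Fin h) (U : Finset (Fin h)) (f : Fin h → ℂ) (g : ℂ) :
    ∏ a ∈ U, (if a = x then g else f a) = (if x ∈ U then g else 1) * ∏ a ∈ U.erase x, f a := by
  by_cases hx : x ∈ U
  · rw [if_pos hx, ← Finset.mul_prod_erase U _ hx, if_pos rfl]
    congr 1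
    exact Finset.prod_congr rfl fun a ha => by rw [if_neg (Finset.ne_of_mem_erase ha)]
  · rw [if_neg hx, one_mul, Finset.erase_eq_of_notMem hx]
    refine Finset.prod_congr rfl fun a ha => ?_
    rw [if_neg]
    rintro rfl
    exact hx ha

/-- At a nonzero reversed scale `Y₀`, `N(Y₀) = diag(Y₀^{[x ∈ u i]}) · M(1/Y₀)`. -/
theorem eval_revMat (x : Fin h) (u : Idx r₀ r₁ → Finset (Fin h)) (z' : Idx r₀ r₁ → Fin h → ℂ) (ξ η : Idx r₀ r₁ → ℂ)
    (Y₀ : ℂ) (hY : Y₀ ≠ 0) :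
    (revMat x u z' ξ η).map (Polynomial.eval Y₀)
      = Matrix.diagonal (fun i => if x ∈ u i then Y₀ else 1) * splitMat x u z' ξ η Y₀⁻¹ := by
  ext i k
  rw [Matrix.diagonal_mul]
  simp only [Matrix.map_apply, revMat, splitMat, Matrix.of_apply, Polynomial.eval_mul, Polynomial.eval_C]
  rw [prod_split x (u i) (z' k) (η k + Y₀⁻¹ * ξ k)]
  by_cases hx : x ∈ u i
  · simp only [if_pos hx, Polynomial.eval_add, Polynomial.eval_C, Polynomial.eval_mul, Polynomial.eval_X]
    field_simp
    ring
  · simp only [if_neg hx, Polynomial.eval_one, one_mul]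

/-- At reversed scale `0`, `N(0)` is block upper-triangular with diagonal blocks `A` (deletion rows × unscaled columns) and `D₁`
(link rows × scaled columns, entries `ξ k ∏_{a ≠ x} z' k a`). -/
theorem eval_revMat_zero (x : Fin h) (u : Idx r₀ r₁ → Finset (Fin h)) (z' : Idx r₀ r₁ → Fin h → ℂ) (ξ η : Idx r₀ r₁ → ℂ)
    (hrow0 : ∀ j, x ∉ u (Sum.inl j)) (hrow1 : ∀ j, x ∈ u (Sum.inr j)) (hcol0 : ∀ j, ξ (Sum.inl j) = 0) :
    (revMat x u z' ξ η).map (Polynomial.eval 0)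
      = Matrix.fromBlocks
          (Matrix.of fun j j' => ∏ a ∈ u (Sum.inl j), z' (Sum.inl j') a)
          (Matrix.of fun j j' => ∏ a ∈ u (Sum.inl j), z' (Sum.inr j') a)
          0
          (Matrix.of fun j j' => ξ (Sum.inr j') * ∏ a ∈ (u (Sum.inr j)).erase x, z' (Sum.inr j') a) := by
  ext i k
  simp only [Matrix.map_apply, revMat, Matrix.of_apply, Polynomial.eval_mul, Polynomial.eval_C]
  rcases i with j | j <;> rcases k with j' | j'
  · simp [Matrix.fromBlocks_apply₁₁, hrow0 j]
  · simp [Matrix.fromBlocks_apply₁₂, hrow0 j]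
  · simp [Matrix.fromBlocks_apply₂₁, hrow1 j, hcol0 j']
  · simp [Matrix.fromBlocks_apply₂₂, hrow1 j]

/-- **THE SPLIT LEMMA.** If the number of scaled columns equals the number of link rows (both index blocks `Fin r₁`), the deletion
rows avoid `x`, the link rows contain `x`, the unscaled columns have `ξ = 0`, and both diagonal blocks are nonsingular — `A` = deletion
rows × unscaled columns on the coordinates `≠ x`, `D₁` = link rows × scaled columns (leading coefficients) — then for some scale `t`
the full matrix `[∏_{a ∈ u i} z_k(a)]` with `z_k(x) = η k + t ξ k` is nonsingular. -/
theorem det_ne_zero_of_split (x : Fin h) (u : Idx r₀ r₁ → Finset (Fin h)) (z' : Idx r₀ r₁ → Fin h → ℂ) (ξ η : Idx r₀ r₁ → ℂ)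
    (hrow0 : ∀ j, x ∉ u (Sum.inl j)) (hrow1 : ∀ j, x ∈ u (Sum.inr j)) (hcol0 : ∀ j, ξ (Sum.inl j) = 0)
    (hA : (Matrix.of fun j j' : Fin r₀ => ∏ a ∈ u (Sum.inl j), z' (Sum.inl j') a).det ≠ 0)
    (hD : (Matrix.of fun j j' : Fin r₁ => ξ (Sum.inr j') * ∏ a ∈ (u (Sum.inr j)).erase x, z' (Sum.inr j') a).det ≠ 0) :
    ∃ t : ℂ, (splitMat x u z' ξ η t).det ≠ 0 := by
  classical
  set N := revMat x u z' ξ η with hN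
  -- det N is a nonzero polynomial: its value at 0 is det A * det D₁
  have h0 : (N.det).eval 0 ≠ 0 := by
    have : (N.det).eval 0 = (N.map (Polynomial.eval 0)).det := by
      rw [show (Polynomial.eval (0 : ℂ)) = (Polynomial.evalRingHom 0 : ℂ[X] →+* ℂ) from rfl, RingHom.map_det]
      rfl
    rw [this, hN, eval_revMat_zero x u z' ξ η hrow0 hrow1 hcol0, Matrix.det_fromBlocks_zero₂₁]
    exact mul_ne_zero hA hD
  have hdet : N.det ≠ 0 := fun h' => h0 (by rw [h', Polynomial.eval_zero])
  -- pick a nonzero non-root Y₀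
  obtain ⟨Y₀, hY₀⟩ := Infinite.exists_notMem_finset (insert (0 : ℂ) N.det.roots.toFinset)
  rw [Finset.mem_insert, not_or, Multiset.mem_toFinset, Polynomial.mem_roots hdet] at hY₀
  obtain ⟨hY0, hYroot⟩ := hY₀
  refine ⟨Y₀⁻¹, fun hM => hYroot ?_⟩
  -- det N(Y₀) = (∏ diag) * det M(1/Y₀) = 0
  show (N.det).eval Y₀ = 0
  have : (N.det).eval Y₀ = (N.map (Polynomial.eval Y₀)).det := by
    rw [show (Polynomial.eval Y₀) = (Polynomial.evalRingHom Y₀ : ℂ[X] →+* ℂ) from rfl, RingHom.map_det]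
    rfl
  rw [this, hN, eval_revMat x u z' ξ η Y₀ hY0, Matrix.det_mul, hM, mul_zero]

/-- **Reindexed form.** The same for a problem indexed by `Fin r` with chosen bijections `er` (rows) and `ec` (columns) from
`Fin r₀ ⊕ Fin r₁`: deletion rows / unscaled columns first. -/
theorem det_ne_zero_of_split' {r : ℕ} (x : Fin h) (u : Fin r → Finset (Fin h)) (z' : Fin r → Fin h → ℂ) (ξ η : Fin r → ℂ)
    (er ec : Idx r₀ r₁ ≃ Fin r)
    (hrow0 : ∀ j, x ∉ u (er (Sum.inl j))) (hrow1 : ∀ j, x ∈ u (er (Sum.inr j))) (hcol0 : ∀ j, ξ (ec (Sum.inl j)) = 0)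
    (hA : (Matrix.of fun j j' : Fin r₀ => ∏ a ∈ u (er (Sum.inl j)), z' (ec (Sum.inl j')) a).det ≠ 0)
    (hD : (Matrix.of fun j j' : Fin r₁ =>
      ξ (ec (Sum.inr j')) * ∏ a ∈ (u (er (Sum.inr j))).erase x, z' (ec (Sum.inr j')) a).det ≠ 0) :
    ∃ t : ℂ, (Matrix.of fun i k : Fin r => ∏ a ∈ u i, (if a = x then η k + t * ξ k else z' k a)).det ≠ 0 := by
  classical
  obtain ⟨t, ht⟩ := det_ne_zero_of_split x (u ∘ er) (z' ∘ ec) (ξ ∘ ec) (η ∘ ec) hrow0 hrow1 hcol0 hA hD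
  refine ⟨t, fun hM => ht ?_⟩
  -- the Idx-indexed matrix is a two-sided reindexing of the Fin-indexed one
  set M : Matrix (Fin r) (Fin r) ℂ := Matrix.of fun i k : Fin r => ∏ a ∈ u i, (if a = x then η k + t * ξ k else z' k a)
  have hsub : splitMat x (u ∘ er) (z' ∘ ec) (ξ ∘ ec) (η ∘ ec) t = M.submatrix er ec := by
    ext i k; rfl
  have : M.submatrix er ec = (M.submatrix er er).submatrix id (ec.trans er.symm) := by
    ext i k; simp
  rw [hsub, this, Matrix.det_permute', Matrix.det_submatrix_equiv_self, hM, mul_zero]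

end Split

end

end Summit.ValiantsHypothesis.ValiantsHypothesis.Theorems.BarrierLever.HiddenStates
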